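import Literature.ModelTheory.FiniteModelTheory.Fagin
import HarnessLib

/-!
# Uniform first-order definability over finite relational structures, and the reduction of
`∃SO`-definability to large structures

Topic `Literature/ModelTheory/FiniteModelTheory`; toolkit for the hard direction of Fagin's
theorem (`Literature.ModelTheory.FiniteModelTheory.fagin_theorem`, `ESO.lean`; the direction `NP ⊆ ∃SO` is the named
fact `NP_subset_eso` of `Fagin.lean`, which this file imports; Libkin 2004, Thm. 9.6). The
printed proof (Libkin 2004, pp. 170–173) writes one first-order sentence `Ψ` over the input
vocabulary expanded by the guessed relations and argues semantically; to do the same in Lean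
without manipulating de Bruijn syntax we introduce

* `JQuery ar wit α` — QUERIES with free variables `α` on finite structures for the joint
  vocabulary (input tables `R : RelTables ar n`, witness tables `W : RelTables wit n`, valuation
  `v : α → Fin n`), i.e. `Prop`-valued functions of `(n, R, W, v)`;
* `JQuery.IsDef Q` — `Q` is UNIFORMLY FIRST-ORDER DEFINABLE: one formula
  `φ : ((relLanguage ar).sum (relLanguage wit)).Formula α` (Mathlib) defines it on every finite
  structure `(Fin n, R, W)`;

and prove the closure properties of definable queries that a semantic construction of `Ψ` needs:
Boolean connectives, finite conjunctions and disjunctions (`Formula.iInf/iSup`), renaming of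
variables (`Formula.relabel`), blocks of quantifiers (`Formula.iAlls/iExs`), the atoms (input
relations, witness relations, equality), cardinality statements (`Sentence.cardGe`), and
ISOMORPHISM INVARIANCE (a definable query is invariant under relabelling the universe). The link
with `ESO.lean`: a definable CLOSED query `Q` gives the `∃SO`-definable class
`{⟨n, R⟩ | ∃ W, Q R W}` (`IsESODefinable.of_isDef`).

Main result of the file (the "small structures are hard-wired" step: Libkin 2004, p. 170,
assumes the encoding is non-trivially large — "`n` is the size of the encoding, so we always
assume `n > 1`" — and a machine running in time `n^k`; here, correspondingly, structures with
fewer than `n₀` elements are hard-wired and only larger ones are left to the main argument):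

* `isDef_isoTo` — for a fixed finite structure `R₀` on `Fin n₀`, "the input structure is
  isomorphic to `R₀`" is first-order (Libkin 2004, Lemma 3.4, the diagram sentence);
* `isDef_sliceOf` — for an isomorphism-closed class `C` and a fixed size `m`, "`n = m` and
  `⟨n, R⟩ ∈ C`" is first-order (finitely many isomorphism types of size `m`);
* `IsESODefinable.of_eventually` — **if an isomorphism-closed class `C` agrees on all structures
  of size `≥ n₀` with `{⟨n, R⟩ | ∃ W, Q R W}` for a definable `Q`, then `C` is `∃SO`-definable.**

## References

* L. Libkin, *Elements of Finite Model Theory*, Springer 2004, §9.2, proof of Thm. 9.6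
  (pp. 170–173); §2.1 (queries are isomorphism-closed); Lemma 3.4, p. 27 ("for every finite
  structure `𝔄` there is a sentence `Φ_𝔄` such that `𝔅 ⊨ Φ_𝔄` iff `𝔅 ≅ 𝔄`"). Page numbers are
  the printed ones (held copy `book:libkinnd-elements-finite-model-theory`: PDF page = printed
  page + 18).
* N. Immerman, *Descriptive Complexity*, Springer 1999, Thm. 7.8.
-/

namespace Literature.ModelTheory.FiniteModelTheory

open Literature.Computability.Cryptography

/-! ### The joint vocabulary and its finite structures -/

/-- The joint vocabulary of inputs `ar` and witnesses `wit` (Mathlib `Language.sum`).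
[Libkin 2004, §9.2 (vocabulary `σ ∪ {L, T₀, T₁, T₂} ∪ {H_q}`)] [folklore] -/
abbrev JointLang (ar wit : List ℕ) : FirstOrder.Language :=
  (relLanguage ar).sum (relLanguage wit)

/-- The joint structure on `Fin n` given by input tables `R` and witness tables `W`.
[Libkin 2004, §9.2] [folklore] -/
abbrev jointStructure {ar wit : List ℕ} {n : ℕ} (R : RelTables ar n) (W : RelTables wit n) :
    (JointLang ar wit).Structure (Fin n) :=
  @FirstOrder.Language.sumStructure _ _ (Fin n) (structureOfTables R) (structureOfTables W)

/-- Queries with free variables `α` on finite joint structures: `Prop`-valued functions of the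
universe size `n`, the input tables, the witness tables and a valuation of `α` in `Fin n`.
[Libkin 2004, §2.1 (queries)] [folklore] -/
abbrev JQuery (ar wit : List ℕ) (α : Type) : Type :=
  ∀ ⦃n : ℕ⦄, RelTables ar n → RelTables wit n → (α → Fin n) → Prop

namespace JQuery

variable {ar wit : List ℕ} {α β : Type}

/-- The query defined by a first-order formula of the joint vocabulary. [Libkin 2004, §2.1]
[folklore] -/
def ofFormula (φ : (JointLang ar wit).Formula α) : JQuery ar wit α :=
  fun n R W v => @FirstOrder.Language.Formula.Realize _ (Fin n) (jointStructure R W) α φ v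

/-- A query is UNIFORMLY FIRST-ORDER DEFINABLE if one formula defines it on all finite joint
structures. [Libkin 2004, §2.1 (definable queries)] [folklore] -/
def IsDef (Q : JQuery ar wit α) : Prop :=
  ∃ φ : (JointLang ar wit).Formula α, ∀ (n : ℕ) (R : RelTables ar n) (W : RelTables wit n)
    (v : α → Fin n), ofFormula φ R W v ↔ Q R W v

/-- Definability is extensional. [folklore] -/
theorem IsDef.of_iff {Q Q' : JQuery ar wit α} (h : IsDef Q)
    (e : ∀ (n : ℕ) (R : RelTables ar n) (W : RelTables wit n) (v : α → Fin n),
      Q R W v ↔ Q' R W v) : IsDef Q' := by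
  obtain ⟨φ, hφ⟩ := h
  exact ⟨φ, fun n R W v => (hφ n R W v).trans (e n R W v)⟩

/-- The query of a formula is definable. [folklore] -/
theorem isDef_ofFormula (φ : (JointLang ar wit).Formula α) : IsDef (ofFormula φ) :=
  ⟨φ, fun _ _ _ _ => Iff.rfl⟩

/-! ### Boolean closure -/

/-- `⊤` is definable. [folklore] -/
theorem isDef_true : IsDef (fun _ (_ : RelTables ar _) (_ : RelTables wit _) (_ : α → _) => True) := by
  refine ⟨⊤, fun n R W v => ?_⟩
  letI := jointStructure R W
  exact FirstOrder.Language.Formula.realize_top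

/-- `⊥` is definable. [folklore] -/
theorem isDef_false :
    IsDef (fun _ (_ : RelTables ar _) (_ : RelTables wit _) (_ : α → _) => False) := by
  refine ⟨⊥, fun n R W v => ?_⟩
  letI := jointStructure R W
  exact FirstOrder.Language.Formula.realize_bot

/-- Negation. [folklore] -/
theorem IsDef.not {Q : JQuery ar wit α} (h : IsDef Q) : IsDef (fun _ R W v => ¬ Q R W v) := by
  obtain ⟨φ, hφ⟩ := h
  refine ⟨φ.not, fun n R W v => ?_⟩
  letI := jointStructure R W
  dsimp only
  rw [← hφ]
  exact FirstOrder.Language.Formula.realize_not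

/-- Conjunction. [folklore] -/
theorem IsDef.and {Q Q' : JQuery ar wit α} (h : IsDef Q) (h' : IsDef Q') :
    IsDef (fun _ R W v => Q R W v ∧ Q' R W v) := by
  obtain ⟨φ, hφ⟩ := h
  obtain ⟨ψ, hψ⟩ := h'
  refine ⟨φ ⊓ ψ, fun n R W v => ?_⟩
  letI := jointStructure R W
  dsimp only
  rw [← hφ, ← hψ]
  exact FirstOrder.Language.Formula.realize_inf

/-- Disjunction. [folklore] -/
theorem IsDef.or {Q Q' : JQuery ar wit α} (h : IsDef Q) (h' : IsDef Q') :
    IsDef (fun _ R W v => Q R W v ∨ Q' R W v) := by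
  obtain ⟨φ, hφ⟩ := h
  obtain ⟨ψ, hψ⟩ := h'
  refine ⟨φ ⊔ ψ, fun n R W v => ?_⟩
  letI := jointStructure R W
  dsimp only
  rw [← hφ, ← hψ]
  exact FirstOrder.Language.Formula.realize_sup

/-- Implication. [folklore] -/
theorem IsDef.imp {Q Q' : JQuery ar wit α} (h : IsDef Q) (h' : IsDef Q') :
    IsDef (fun _ R W v => Q R W v → Q' R W v) := by
  obtain ⟨φ, hφ⟩ := h
  obtain ⟨ψ, hψ⟩ := h'
  refine ⟨φ.imp ψ, fun n R W v => ?_⟩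
  letI := jointStructure R W
  dsimp only
  rw [← hφ, ← hψ]
  exact FirstOrder.Language.Formula.realize_imp

/-- Bi-implication. [folklore] -/
theorem IsDef.iff {Q Q' : JQuery ar wit α} (h : IsDef Q) (h' : IsDef Q') :
    IsDef (fun _ R W v => (Q R W v ↔ Q' R W v)) := by
  obtain ⟨φ, hφ⟩ := h
  obtain ⟨ψ, hψ⟩ := h'
  refine ⟨φ.iff ψ, fun n R W v => ?_⟩
  letI := jointStructure R W
  dsimp only
  rw [← hφ, ← hψ]
  exact FirstOrder.Language.Formula.realize_iff

/-- Finite conjunction. [folklore] -/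
theorem IsDef.iInf {ι : Type} [Finite ι] {Q : ι → JQuery ar wit α} (h : ∀ i, IsDef (Q i)) :
    IsDef (fun _ R W v => ∀ i, Q i R W v) := by
  choose φ hφ using h
  refine ⟨FirstOrder.Language.Formula.iInf φ, fun n R W v => ?_⟩
  letI := jointStructure R W
  dsimp only
  simp only [← hφ]
  exact FirstOrder.Language.Formula.realize_iInf

/-- Finite disjunction. [folklore] -/
theorem IsDef.iSup {ι : Type} [Finite ι] {Q : ι → JQuery ar wit α} (h : ∀ i, IsDef (Q i)) :
    IsDef (fun _ R W v => ∃ i, Q i R W v) := by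
  choose φ hφ using h
  refine ⟨FirstOrder.Language.Formula.iSup φ, fun n R W v => ?_⟩
  letI := jointStructure R W
  dsimp only
  simp only [← hφ]
  exact FirstOrder.Language.Formula.realize_iSup

/-- Conjunction over a finite set of indices (e.g. a `Finset`, via its subtype). [folklore] -/
theorem IsDef.ball {ι : Type} (s : Set ι) [Finite s] {Q : ι → JQuery ar wit α}
    (h : ∀ i ∈ s, IsDef (Q i)) : IsDef (fun _ R W v => ∀ i ∈ s, Q i R W v) :=
  (IsDef.iInf (ι := s) fun i => h i.1 i.2).of_iff fun _ _ _ _ =>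
    ⟨fun H i hi => H ⟨i, hi⟩, fun H i => H i.1 i.2⟩

/-- Disjunction over a finite set of indices. [folklore] -/
theorem IsDef.bex {ι : Type} (s : Set ι) [Finite s] {Q : ι → JQuery ar wit α}
    (h : ∀ i ∈ s, IsDef (Q i)) : IsDef (fun _ R W v => ∃ i ∈ s, Q i R W v) :=
  (IsDef.iSup (ι := s) fun i => h i.1 i.2).of_iff fun _ _ _ _ =>
    ⟨fun ⟨i, H⟩ => ⟨i.1, i.2, H⟩, fun ⟨i, hi, H⟩ => ⟨⟨i, hi⟩, H⟩⟩

/-! ### Variables: renaming and quantifier blocks -/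

/-- Renaming the free variables along `g : α → β` (substitution of variables for variables).
[folklore] -/
theorem IsDef.relabel {Q : JQuery ar wit α} (h : IsDef Q) (g : α → β) :
    IsDef (fun n R W (v : β → Fin n) => Q R W (v ∘ g)) := by
  obtain ⟨φ, hφ⟩ := h
  refine ⟨φ.relabel g, fun n R W v => ?_⟩
  letI := jointStructure R W
  dsimp only
  rw [← hφ]
  exact FirstOrder.Language.Formula.realize_relabel

/-- Universal quantification of a finite BLOCK of variables `β` (Mathlib `Formula.iAlls`).
[folklore] -/
theorem IsDef.alls {β : Type} [Finite β] {Q : JQuery ar wit (α ⊕ β)} (h : IsDef Q) :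
    IsDef (fun n R W (v : α → Fin n) => ∀ w : β → Fin n, Q R W (Sum.elim v w)) := by
  obtain ⟨φ, hφ⟩ := h
  refine ⟨φ.iAlls β, fun n R W v => ?_⟩
  letI := jointStructure R W
  dsimp only
  simp only [← hφ]
  exact FirstOrder.Language.Formula.realize_iAlls

/-- Existential quantification of a finite block of variables `β` (Mathlib `Formula.iExs`).
[folklore] -/
theorem IsDef.exs {β : Type} [Finite β] {Q : JQuery ar wit (α ⊕ β)} (h : IsDef Q) :
    IsDef (fun n R W (v : α → Fin n) => ∃ w : β → Fin n, Q R W (Sum.elim v w)) := by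
  obtain ⟨φ, hφ⟩ := h
  refine ⟨φ.iExs β, fun n R W v => ?_⟩
  letI := jointStructure R W
  dsimp only
  simp only [← hφ]
  exact FirstOrder.Language.Formula.realize_iExs

/-- Universal quantification of ONE variable: from a query on `α ⊕ Unit`. [folklore] -/
theorem IsDef.all {Q : JQuery ar wit (α ⊕ Unit)} (h : IsDef Q) :
    IsDef (fun n R W (v : α → Fin n) => ∀ x : Fin n, Q R W (Sum.elim v fun _ => x)) :=
  h.alls.of_iff fun _ _ _ _ =>
    ⟨fun H x => H fun _ => x, fun H w => by
      have : w = fun _ => w () := funext fun u => by cases u; rfl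
      rw [this]; exact H (w ())⟩

/-- Existential quantification of ONE variable. [folklore] -/
theorem IsDef.ex {Q : JQuery ar wit (α ⊕ Unit)} (h : IsDef Q) :
    IsDef (fun n R W (v : α → Fin n) => ∃ x : Fin n, Q R W (Sum.elim v fun _ => x)) :=
  h.exs.of_iff fun _ _ _ _ =>
    ⟨fun ⟨w, H⟩ => ⟨w (), by
      have : w = fun _ => w () := funext fun u => by cases u; rfl
      rw [← this]; exact H⟩, fun ⟨x, H⟩ => ⟨fun _ => x, H⟩⟩

/-- A CLOSED definable query (variables `Empty`) may be used with any variable type: its value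
does not depend on the valuation. [folklore] -/
theorem IsDef.ofClosed {Q : JQuery ar wit Empty} (h : IsDef Q) :
    IsDef (fun n R W (_ : α → Fin n) => Q R W Empty.elim) :=
  (h.relabel (Empty.elim : Empty → α)).of_iff fun _ _ _ v => by
    rw [show v ∘ Empty.elim = Empty.elim from funext fun x => x.elim]

/-! ### Atoms -/

/-- Equality of two variables. [folklore] -/
theorem isDef_eq (a b : α) :
    IsDef (fun _ (_ : RelTables ar _) (_ : RelTables wit _) (v : α → _) => v a = v b) := by
  refine ⟨FirstOrder.Language.Term.equal (FirstOrder.Language.Term.var a)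
    (FirstOrder.Language.Term.var b), fun n R W v => ?_⟩
  letI := jointStructure R W
  exact FirstOrder.Language.Formula.realize_equal

/-- An input atom: the input relation number `s` applied to the variables `args`.
[Libkin 2004, §2.1] [folklore] -/
theorem isDef_inRel (s : Fin ar.length) (args : Fin (ar.get s) → α) :
    IsDef (fun _ (R : RelTables ar _) (_ : RelTables wit _) (v : α → _) =>
      R s (v ∘ args) = true) := by
  refine ⟨FirstOrder.Language.Relations.formula (Sum.inl ⟨s, rfl⟩ :
      (JointLang ar wit).Relations (ar.get s)) fun i => FirstOrder.Language.Term.var (args i),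
    fun n R W v => ?_⟩
  letI := jointStructure R W
  unfold ofFormula
  rw [FirstOrder.Language.Formula.realize_rel]
  exact Iff.rfl

/-- A witness atom: the witness relation number `s` applied to the variables `args`.
[Libkin 2004, §9.2] [folklore] -/
theorem isDef_witRel (s : Fin wit.length) (args : Fin (wit.get s) → α) :
    IsDef (fun _ (_ : RelTables ar _) (W : RelTables wit _) (v : α → _) =>
      W s (v ∘ args) = true) := by
  refine ⟨FirstOrder.Language.Relations.formula (Sum.inr ⟨s, rfl⟩ :
      (JointLang ar wit).Relations (wit.get s)) fun i => FirstOrder.Language.Term.var (args i),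
    fun n R W v => ?_⟩
  letI := jointStructure R W
  unfold ofFormula
  rw [FirstOrder.Language.Formula.realize_rel]
  exact Iff.rfl

/-- A query that is a fixed proposition `P` not depending on the structure is definable
(classically `P` is `⊤` or `⊥`). [folklore] -/
theorem isDef_const (P : Prop) :
    IsDef (fun _ (_ : RelTables ar _) (_ : RelTables wit _) (_ : α → _) => P) := by
  by_cases hP : P
  · exact isDef_true.of_iff fun _ _ _ _ => by simp [hP]
  · exact isDef_false.of_iff fun _ _ _ _ => by simp [hP]

/-- A Boolean-valued input atom compared with a fixed Boolean. [folklore] -/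
theorem isDef_inRel_eq (s : Fin ar.length) (args : Fin (ar.get s) → α) (b : Bool) :
    IsDef (fun _ (R : RelTables ar _) (_ : RelTables wit _) (v : α → _) =>
      R s (v ∘ args) = b) := by
  cases b
  · exact (isDef_inRel s args).not.of_iff fun _ _ _ _ => by simp
  · exact isDef_inRel s args

/-! ### Cardinality statements -/

/-- "The universe has at least `m` elements" (Mathlib `Sentence.cardGe`). [folklore] -/
theorem isDef_card_ge (m : ℕ) :
    IsDef (fun n (_ : RelTables ar n) (_ : RelTables wit n) (_ : α → Fin n) => m ≤ n) := by
  have hc : IsDef (fun n (_ : RelTables ar n) (_ : RelTables wit n) (_ : Empty → Fin n) =>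
      m ≤ n) := by
    refine ⟨FirstOrder.Language.Sentence.cardGe _ m, fun n R W v => ?_⟩
    letI := jointStructure R W
    have := FirstOrder.Language.Sentence.realize_cardGe (L := JointLang ar wit) (M := Fin n) m
    rw [Cardinal.mk_fin, Nat.cast_le] at this
    dsimp only
    rw [← this, FirstOrder.Language.Sentence.Realize]
    unfold ofFormula
    rw [Subsingleton.elim v default]
  exact hc.ofClosed

/-- "The universe has exactly `m` elements". [folklore] -/
theorem isDef_card_eq (m : ℕ) :
    IsDef (fun n (_ : RelTables ar n) (_ : RelTables wit n) (_ : α → Fin n) => n = m) :=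
  ((isDef_card_ge m).and (isDef_card_ge (m + 1)).not).of_iff fun _ _ _ _ => by omega

end JQuery

/-! ### Isomorphism invariance of definable queries -/

/-- Transport of FORMULA satisfaction along a bijection respecting the relations: the
formula-level twin (valuations `v` carried along `e`) of the sentence-level
`realize_sentence_iff_of_relEquiv` of `Fagin.lean`, which it does not subsume (free variables).
[Libkin 2004, §2.1] [folklore] -/
theorem realize_formula_iff_of_relEquiv {L : FirstOrder.Language} [L.IsRelational]
    {M N : Type} (SM : L.Structure M) (SN : L.Structure N) (e : M ≃ N)
    (h : ∀ {k : ℕ} (r : L.Relations k) (v : Fin k → M),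
      @FirstOrder.Language.Structure.RelMap L N SN k r (e ∘ v) ↔
        @FirstOrder.Language.Structure.RelMap L M SM k r v)
    {α : Type} (φ : L.Formula α) (v : α → M) :
    @FirstOrder.Language.Formula.Realize L N SN α φ (e ∘ v) ↔
      @FirstOrder.Language.Formula.Realize L M SM α φ v := by
  letI := SM
  letI := SN
  let g : FirstOrder.Language.Equiv L M N :=
    { toEquiv := e
      map_fun' := fun f => isEmptyElim f
      map_rel' := fun r v => h r v }
  exact FirstOrder.Language.StrongHomClass.realize_formula g φ

namespace JQuery

variable {ar wit : List ℕ} {α : Type}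

/-- **Definable queries are isomorphism-invariant**: relabelling inputs, witnesses and the
valuation by the same permutation of `Fin n` does not change the answer.
[Libkin 2004, §2.1 ("queries are closed under isomorphism"), used on p. 171] [folklore] -/
theorem IsDef.invariant {Q : JQuery ar wit α} (h : IsDef Q) {n : ℕ} (R : RelTables ar n)
    (W : RelTables wit n) (v : α → Fin n) (π : Equiv.Perm (Fin n)) :
    Q (relabelTables R π) (relabelTables W π) (π ∘ v) ↔ Q R W v := by
  obtain ⟨φ, hφ⟩ := h
  rw [← hφ, ← hφ]
  unfold ofFormula
  refine realize_formula_iff_of_relEquiv (M := Fin n) (N := Fin n) _ _ π ?_ φ v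
  rintro k (r | r) w
  · simp only [FirstOrder.Language.relMap_sumInl]
    exact relMap_structureOfTables_relabelTables R π r w
  · simp only [FirstOrder.Language.relMap_sumInr]
    exact relMap_structureOfTables_relabelTables W π r w

end JQuery

/-! ### From definable closed queries to `∃SO`-definable classes -/

/-- The class of finite structures CUT OUT by a closed query with guessed witnesses:
`{⟨n, R⟩ | ∃ W, Q R W}`. [Libkin 2004, §9.2 ((9.1))] [folklore] -/
def classOf {ar wit : List ℕ} (Q : JQuery ar wit Empty) : Set (SNPInstance ar) :=
  {x | ∃ W : RelTables wit x.1, Q x.2 W Empty.elim}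

/-- Membership in `classOf Q`. [folklore] -/
@[simp] theorem mem_classOf_iff {ar wit : List ℕ} (Q : JQuery ar wit Empty) (n : ℕ)
    (R : RelTables ar n) : (⟨n, R⟩ : SNPInstance ar) ∈ classOf Q ↔ ∃ W : RelTables wit n,
      Q R W Empty.elim :=
  Iff.rfl

/-- **A definable closed query defines an `∃SO`-definable class**: `{⟨n, R⟩ | ∃ W, Q R W}` is
the model class of `∃ S̄ φ` for the formula `φ` defining `Q`. [Libkin 2004, §9.2 ((9.1))]
[folklore] -/
theorem IsESODefinable.of_isDef {ar wit : List ℕ} {Q : JQuery ar wit Empty} (hQ : Q.IsDef) :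
    IsESODefinable ar (classOf Q) := by
  obtain ⟨φ, hφ⟩ := hQ
  refine ⟨⟨wit, φ⟩, Set.ext fun ⟨n, R⟩ => ?_⟩
  change ESOSentence.HoldsOnTables _ _ _ ↔ _
  rw [ESOSentence.holdsOnTables_iff, mem_classOf_iff]
  refine exists_congr fun W => ?_
  rw [← hφ n R W Empty.elim]
  unfold JQuery.ofFormula FirstOrder.Language.Sentence.Realize
  rw [Subsingleton.elim (default : Empty → Fin n) Empty.elim]

/-- A class given extensionally by a definable closed query is `∃SO`-definable. [folklore] -/
theorem IsESODefinable.of_isDef_iff {ar wit : List ℕ} {C : Set (SNPInstance ar)}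
    {Q : JQuery ar wit Empty} (hQ : Q.IsDef)
    (hC : ∀ (n : ℕ) (R : RelTables ar n), (⟨n, R⟩ : SNPInstance ar) ∈ C ↔
      ∃ W : RelTables wit n, Q R W Empty.elim) :
    IsESODefinable ar C := by
  have : C = classOf Q := Set.ext fun ⟨n, R⟩ => hC n R
  rw [this]
  exact IsESODefinable.of_isDef hQ

/-! ### Hard-wiring small structures -/

section Small

variable {ar wit : List ℕ}

/-- "The input structure is ISOMORPHIC TO the fixed finite structure `R₀` on `Fin n₀`": some
bijection `e : Fin n₀ → Fin n` carries the tables of `R₀` onto those of the input.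
[Libkin 2004, Lemma 3.4] [folklore] -/
def IsoTo {n₀ : ℕ} (R₀ : RelTables ar n₀) : JQuery ar wit Empty :=
  fun n R _ _ => ∃ e : Fin n₀ → Fin n, Function.Bijective e ∧
    ∀ (s : Fin ar.length) (args : Fin (ar.get s) → Fin n₀), R s (e ∘ args) = R₀ s args

/-- **The isomorphism type of a fixed finite structure is first-order definable** (Libkin 2004,
Lemma 3.4: "for every finite structure `𝔄` there is a sentence `Φ_𝔄` such that `𝔅 ⊨ Φ_𝔄` iff
`𝔅 ≅ 𝔄`"; the sentence `∃ x₁ … x_{n₀} (⋀_{i ≠ j} xᵢ ≠ xⱼ ∧ ∀ y ⋁ᵢ y = xᵢ ∧ diagram of R₀)`).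
[cite: Libkin2004, Lemma 3.4] -/
theorem isDef_isoTo {n₀ : ℕ} (R₀ : RelTables ar n₀) : (IsoTo (wit := wit) R₀).IsDef := by
  -- the matrix, with the images `x₁ … x_{n₀}` as free variables `Sum.inr i`
  have hinj : JQuery.IsDef (fun _ (_ : RelTables ar _) (_ : RelTables wit _)
      (v : Empty ⊕ Fin n₀ → _) => ∀ p : Fin n₀ × Fin n₀,
        p.1 = p.2 ∨ ¬ v (Sum.inr p.1) = v (Sum.inr p.2)) :=
    JQuery.IsDef.iInf fun p => (JQuery.isDef_const (p.1 = p.2)).or (JQuery.isDef_eq _ _).not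
  have hsurj : JQuery.IsDef (fun _ (_ : RelTables ar _) (_ : RelTables wit _)
      (v : Empty ⊕ Fin n₀ → _) => ∀ y, ∃ i : Fin n₀, y = v (Sum.inr i)) := by
    have := (JQuery.IsDef.iSup (ι := Fin n₀) fun i =>
      JQuery.isDef_eq (ar := ar) (wit := wit) (α := (Empty ⊕ Fin n₀) ⊕ Unit)
        (Sum.inr ()) (Sum.inl (Sum.inr i))).all
    exact this.of_iff fun _ _ _ _ => Iff.rfl
  have hdiag : JQuery.IsDef (fun _ (R : RelTables ar _) (_ : RelTables wit _)
      (v : Empty ⊕ Fin n₀ → _) => ∀ s : Fin ar.length, ∀ args : Fin (ar.get s) → Fin n₀,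
        R s (v ∘ Sum.inr ∘ args) = R₀ s args) :=
    JQuery.IsDef.iInf fun s => JQuery.IsDef.iInf fun args =>
      JQuery.isDef_inRel_eq s (Sum.inr ∘ args) (R₀ s args)
  refine ((hinj.and hsurj).and hdiag).exs.of_iff fun n R W v => ?_
  constructor
  · rintro ⟨w, ⟨hi, hs⟩, hd⟩
    refine ⟨w, ⟨fun i j hij => ?_, fun y => ?_⟩, fun s args => ?_⟩
    · rcases hi (i, j) with h | h
      · exact h
      · exact absurd (by simpa using hij) h
    · obtain ⟨i, hi⟩ := hs y
      exact ⟨i, by simpa using hi.symm⟩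
    · have := hd s args
      rwa [← Function.comp_assoc, Sum.elim_comp_inr] at this
  · rintro ⟨e, ⟨hi, hs⟩, hd⟩
    refine ⟨e, ⟨fun p => ?_, fun y => ?_⟩, fun s args => ?_⟩
    · by_cases h : p.1 = p.2
      · exact Or.inl h
      · exact Or.inr fun h' => h (hi (by simpa using h'))
    · obtain ⟨i, hi⟩ := hs y
      exact ⟨i, by simpa using hi.symm⟩
    · rw [← Function.comp_assoc, Sum.elim_comp_inr]
      exact hd s args

/-- If a bijection `e : Fin m → Fin n` carries `R₀` onto `R`, then `n = m` and `R` is a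
relabelling of `R₀`. [folklore] -/
theorem exists_relabel_of_isoTo {m n : ℕ} {R₀ : RelTables ar m} {R : RelTables ar n}
    {W : RelTables wit n} {v : Empty → Fin n} (h : IsoTo R₀ R W v) :
    ∃ hnm : n = m, ∃ π : Equiv.Perm (Fin m), hnm ▸ R = relabelTables R₀ π := by
  obtain ⟨e, he, hd⟩ := h
  obtain rfl : n = m := by simpa using (Fintype.card_of_bijective he).symm
  refine ⟨rfl, Equiv.ofBijective e he, ?_⟩
  funext s w
  have := hd s ((Equiv.ofBijective e he).symm ∘ w)
  rw [← Function.comp_assoc] at this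
  change R s ((⇑(Equiv.ofBijective e he) ∘ ⇑(Equiv.ofBijective e he).symm) ∘ w) = _ at this
  rw [Equiv.self_comp_symm, Function.id_comp] at this
  exact this

/-- The SLICE of a class at size `m`, as a closed query: "`n = m` and `⟨n, R⟩ ∈ C`".
[Libkin 2004, p. 170 (small structures)] [folklore] -/
def SliceOf (C : Set (SNPInstance ar)) (m : ℕ) : JQuery ar wit Empty :=
  fun n R _ _ => n = m ∧ (⟨n, R⟩ : SNPInstance ar) ∈ C

/-- **Every slice of an isomorphism-closed class is first-order definable**: it is the finite
disjunction, over the structures `R₀` of size `m` in the class, of "isomorphic to `R₀`".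
[Libkin 2004, Lemma 3.4 and p. 170] [folklore] -/
theorem isDef_sliceOf {C : Set (SNPInstance ar)} (hC : IsIsoClosedStr ar C) (m : ℕ) :
    (SliceOf (wit := wit) C m).IsDef := by
  let S : Set (RelTables ar m) := {R₀ | (⟨m, R₀⟩ : SNPInstance ar) ∈ C}
  haveI : Finite S := Subtype.finite
  refine (JQuery.IsDef.bex S fun R₀ _ => isDef_isoTo (wit := wit) R₀).of_iff fun n R W v => ?_
  constructor
  · rintro ⟨R₀, hR₀, hiso⟩
    obtain ⟨rfl, π, hR⟩ := exists_relabel_of_isoTo hiso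
    refine ⟨rfl, ?_⟩
    rw [show R = relabelTables R₀ π from hR]
    exact (hC _ R₀ π).1 hR₀
  · rintro ⟨rfl, hR⟩
    exact ⟨R, hR, id, Function.bijective_id, fun s args => rfl⟩

/-- **`∃SO`-definability may be checked on large structures only.** If `C` is
isomorphism-closed and, for all structures with at least `n₀` elements, membership in `C` is
"some witness tables satisfy the definable closed query `Q`", then `C` is `∃SO`-definable: the
finitely many isomorphism types below `n₀` are hard-wired (`isDef_sliceOf`) and selected by
cardinality sentences. (Libkin 2004, p. 170, only assumes the ENCODING is non-trivially large;
this lemma is the form of that reduction needed when rows and positions are coded by tuples of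
universe elements: structures with fewer than `n₀` elements are hard-wired.) [folklore] -/
theorem IsESODefinable.of_eventually {C : Set (SNPInstance ar)} (hC : IsIsoClosedStr ar C)
    (n₀ : ℕ) {Q : JQuery ar wit Empty} (hQ : Q.IsDef)
    (h : ∀ (n : ℕ), n₀ ≤ n → ∀ R : RelTables ar n,
      ((⟨n, R⟩ : SNPInstance ar) ∈ C ↔ ∃ W : RelTables wit n, Q R W Empty.elim)) :
    IsESODefinable ar C := by
  have hQ' : JQuery.IsDef (fun n (R : RelTables ar n) (W : RelTables wit n) (v : Empty → Fin n) =>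
      (n₀ ≤ n ∧ Q R W v) ∨ ∃ i : Fin n₀, SliceOf C i R W v) :=
    ((JQuery.isDef_card_ge n₀).and hQ).or (JQuery.IsDef.iSup fun i => isDef_sliceOf hC i)
  refine IsESODefinable.of_isDef_iff hQ' fun n R => ?_
  by_cases hn : n₀ ≤ n
  · rw [h n hn R]
    refine exists_congr fun W => ?_
    rw [Subsingleton.elim (Empty.elim : Empty → Fin n) Empty.elim]
    constructor
    · exact fun hW => Or.inl ⟨hn, hW⟩
    · rintro (⟨-, hW⟩ | ⟨i, hi, -⟩)
      · exact hW
      · exact absurd hn (by rw [hi]; exact not_le.2 i.2)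
  · constructor
    · intro hR
      exact ⟨fun _ _ => false, Or.inr ⟨⟨n, not_le.1 hn⟩, rfl, hR⟩⟩
    · rintro ⟨W, ⟨hn', -⟩ | ⟨i, -, hR⟩⟩
      · exact absurd hn' hn
      · exact hR

end Small

end Literature.ModelTheory.FiniteModelTheory
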